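import Mathlib
import Summits.Ventures.HodgeRepro.Tier4.Common.AdelicDefs
import Summits.Ventures.HodgeRepro.Tier4.Common.MixedPlaneCusp
import Summits.Ventures.HodgeRepro.Tier4.Common.CocompactBridge
import Summits.Ventures.HodgeRepro.Tier4.Line1.PlaneDefs
import Summits.Ventures.HodgeRepro.Tier4.Line1.TorusElement
import Summits.Ventures.HodgeRepro.Tier4.Line1.TorusPlaneData
import Summits.Ventures.HodgeRepro.Tier4.Line1.NormOneTorus
import Summits.Ventures.HodgeRepro.Tier4.Line1.CocompactReduction
import Summits.Ventures.HodgeRepro.Tier4.Line1.TorusCocompact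

/-!
# Tier4/Line4/TorusCocompactAniso — the tori `T`, `T′` of an ANISOTROPIC genuine plane are cocompact modulo their
rational points, and the RTF torus data exist from the characters alone (the (C) half of the L4 bridge, torus side)

Blind re-derivation cell `pub-hodge-repro`, Tier 4 «prove the step» (README §9–§10), seat t4-L4-p2 (prover, LINE L4,
gen 6).  Tree path `lean/Summits/Ventures/HodgeRepro/Tier4/Line4/TorusCocompactAniso.lean`.  Mathlib + the tree only;
no printed input; no definition; no instance.

WHAT IS PROVED.  t4-L1-p5's TORUS BRIDGE (`Line1/TorusCocompact`: `cocompact_rationalOf_commutant_pair`, hstab rung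
(ii) `normOneTorusCocompact` applied to the two norm-one scalars of a projector pair) takes `hW : IsDefinite W`, but uses
it ONLY through the field `hdef : ∀ u ≠ 0, u ⬝ᵥ (B *ᵥ u) ≠ 0` of `planeTorusData` — which is ANISOTROPY of the plane,
not definiteness.  Here the same construction and the same proof run on `hA : IsAnisotropic W`
(`Common/MixedPlaneCusp`): `cocompact_rationalOf_commutant_pair_of_anisotropic` (L1-p5's proof verbatim, the torus data
built INLINE as a `TorusData` literal with `hdef := fun u hu h => hA ⟨u, hu, h⟩` — no new definition in this module), hence
* `cocompact_rationalOf_torusT_of_anisotropic` / `cocompact_rationalOf_torusT'_of_anisotropic` (R-c′ / R-c″ on an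
  anisotropic genuine plane), their named forms `isCocompactRational_torusT_of_anisotropic` /
  `isCocompactRational_torusT'_of_anisotropic` (typer-2's `IsCocompactRational`, by `rfl`), the quotient-compact forms
  `torus_quotient_compact_of_genuine_aniso` / `torus'_quotient_compact_of_genuine_aniso`, and
* `exists_rtfData_isHaar_closure_of_anisotropic` — typer-2's `exists_rtfData_isHaar_closure` with the two
  cocompactness hypotheses discharged: for an anisotropic genuine plane and two characters `χ`, `χ′` of the adelic tori
  (multiplicative, trivial on the rational points, matching on the centre), an `RTFData W` with these characters,
  Haar torus measures and measurable, relatively compact fundamental domains EXISTS.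

WHY IT MATTERS FOR LINE L4.  The wall `mixed_two_torus_W3` is displayed on the seesaw plane, which is `(1,1)` at `w₀`
and definite elsewhere — anisotropic (L2-p2's `SeesawAnisotropic`, under the dictionary) but NOT definite; L1-p5's
definite theorems do not apply to it, and the wall census §16 (C) listed the torus domains `compT compT'` (with `R`,
`_hR`) among the bridge's unproduced data.  With this module the torus half of (C) is by name from `hA` and the
characters (bridge half (B)); the plane-group half (`μ DG fdG compG`) is L1-p5's `quotient_compact_genuine_aniso`
(RealisedSettingAniso) from the typed print `Lit.BorelHarishChandra1962_Thm11_8_cocompact_plane_aniso` (lit-3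
p696518) — so (C) is by name modulo ONE typed print.  Nothing here says anything about the status of the Hodge
conjecture for CM abelian varieties, which is NOT proved; HC_CM is NOT proved by anyone in this repository.
-/

set_option autoImplicit false

noncomputable section

namespace Summit.Ventures.HodgeRepro.Tier4.Line4

open NumberField MeasureTheory Summit.Ventures.HodgeRepro.Tier4.Common Summit.Ventures.HodgeRepro.Tier4.Line1
  Matrix Rot Topology

variable {k : Type} [Field k] [NumberField k] (W : PlaneData k)

section Assembly

variable {W}

/-- **R-c′ for a projector pair of an ANISOTROPIC genuine plane** — L1-p5's `cocompact_rationalOf_commutant_pair`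
(TorusCocompact) with `hW : IsDefinite W` replaced by `hA : IsAnisotropic W`; proof verbatim, the torus data of
L1-p5's `planeTorusData` written inline with `hdef` from `hA`: every `g ∈ T` is `torusElt ρ` for a pair `ρ` of norm-one scalars, hstab rung (ii)
(`normOneTorusCocompact`) writes each half as rational · compact, so `T = T(k) · C` with `C` compact. -/
theorem cocompact_rationalOf_commutant_pair_of_anisotropic (hg : IsGenuineRow W) (hA : IsAnisotropic W)
    {P : Fin 2 → Matrix (Fin 4) (Fin 4) k} (hP : ProjPair W P) :
    ∃ C : Set (commutant W (P 0) ⊓ commutant W (P 1) : Subgroup (GA W)), IsCompact C ∧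
      ∀ x : (commutant W (P 0) ⊓ commutant W (P 1) : Subgroup (GA W)),
        ∃ γ : rationalOf W (commutant W (P 0) ⊓ commutant W (P 1)), ∃ c ∈ C,
          x = (γ : (commutant W (P 0) ⊓ commutant W (P 1) : Subgroup (GA W))) * c := by
  classical
  obtain ⟨⟨d, hΩ, hd⟩, hrow, -, -, -, -⟩ := hg
  obtain ⟨v, hv, hv0⟩ := exists_row_ne_zero (hP.rank 0) (hP.idem 0)
  obtain ⟨w, hw, hw1⟩ := exists_row_ne_zero (hP.rank 1) (hP.idem 1)
  set D : TorusData k :=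
    {
      B := W.B,
      Om := W.Ωᵀ,
      P := (P 0)ᵀ,
      d := d,
      v := v,
      w := w,
      hB := W.B_symm,
      hherm := by rw [Matrix.transpose_transpose]; exact hrow,
      hOm := by
        rw [← Matrix.transpose_mul, hΩ, Matrix.transpose_neg, Matrix.transpose_smul, Matrix.transpose_one],
      hd := hd,
      hdef := fun u hu h => hA ⟨u, hu, h⟩,
      hv := hv,
      hw := hw,
      hwv := by
        have hv' : (P 0)ᵀ *ᵥ v = v := by rw [mulVec_transpose]; exact hv0
        have hw' : (P 1)ᵀ *ᵥ w = w := by rw [mulVec_transpose]; exact hw1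
        rw [pair_comm W.B_symm]
        exact hP.pair_eq_zero hv' hw',
      hwOv := by
        have hv' : (P 0)ᵀ *ᵥ v = v := by rw [mulVec_transpose]; exact hv0
        have hw' : (P 1)ᵀ *ᵥ w = w := by rw [mulVec_transpose]; exact hw1
        rw [pair_comm W.B_symm]
        exact hP.pair_eq_zero (hP.mulVec_Ω 0 hv') hw',
      hPv := by rw [mulVec_transpose]; exact hv0,
      hPOv := by
        have hv' : (P 0)ᵀ *ᵥ v = v := by rw [mulVec_transpose]; exact hv0
        exact hP.mulVec_Ω 0 hv',
      hPw := by
        have hw' : (P 1)ᵀ *ᵥ w = w := by rw [mulVec_transpose]; exact hw1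
        exact hP.mulVec_eq_zero hw',
      hPOw := by
        have hw' : (P 1)ᵀ *ᵥ w = w := by rw [mulVec_transpose]; exact hw1
        exact hP.mulVec_eq_zero (hP.mulVec_Ω 1 hw') } with hDdef
  have hDB : D.B = W.B := rfl
  have hDOm : D.Om = W.Ωᵀ := rfl
  have hDP : D.P = (P 0)ᵀ := rfl
  have hDd : D.d = d := rfl
  haveI := Line1.t2Space_adeleRing k
  -- hstab rung (ii)
  obtain ⟨C₀, hC₀, hcov⟩ := normOneTorusCocompact d hd
  -- the compact set of norm-one pairs with both halves in `C₀`
  set N : Set (Fin 4 → Ad k) := {ρ | TorusData.IsNormOne (algebraMap k (Ad k) D.d) ρ} with hNdef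
  have hN : IsClosed N := by
    have h1 : IsClosed {ρ : Fin 4 → Ad k | ρ 0 * ρ 0 + algebraMap k (Ad k) D.d * (ρ 1 * ρ 1) = 1} :=
      isClosed_eq (by fun_prop) continuous_const
    have h2 : IsClosed {ρ : Fin 4 → Ad k | ρ 2 * ρ 2 + algebraMap k (Ad k) D.d * (ρ 3 * ρ 3) = 1} :=
      isClosed_eq (by fun_prop) continuous_const
    exact h1.inter h2
  set K : Set (Fin 4 → Ad k) :=
    (fun p : (Fin 2 → Ad k) × (Fin 2 → Ad k) => ![p.1 0, p.1 1, p.2 0, p.2 1]) '' (C₀ ×ˢ C₀) with hKdef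
  have hK : IsCompact K := by
    refine (hC₀.prod hC₀).image ?_
    refine continuous_pi fun i => ?_
    fin_cases i <;> fun_prop
  have hKN : IsCompact ((Subtype.val : N → (Fin 4 → Ad k)) ⁻¹' K) :=
    hN.isClosedEmbedding_subtypeVal.isCompact_preimage hK
  let Φ : N → (commutant W (P 0) ⊓ commutant W (P 1) : Subgroup (GA W)) := fun ρ =>
    ⟨torusElt D hDB hDOm ρ.1 ρ.2, torusElt_mem D hDB hDOm hDP hP ρ.1 ρ.2⟩
  have hΦ : Continuous Φ := (continuous_torusElt D hDB hDOm).subtype_mk _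
  refine ⟨Φ '' (Subtype.val ⁻¹' K), hKN.image hΦ, ?_⟩
  intro x
  obtain ⟨ρ, hρ, hρx⟩ := exists_pair_of_mem D hDB hDOm hDP (x : GA W) x.2.1
  have hx : (x : GA W) = torusElt D hDB hDOm ρ hρ := Subtype.ext (Units.ext hρx)
  -- rung (ii) on the two scalars
  obtain ⟨γ₀, hγ₀, c₀, hc₀C, hc₀N, h₀⟩ := hcov ![ρ 0, ρ 1] (by simpa [qnorm, hDd] using hρ.1)
  obtain ⟨γ₁, hγ₁, c₁, hc₁C, hc₁N, h₁⟩ := hcov ![ρ 2, ρ 3] (by simpa [qnorm, hDd] using hρ.2)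
  set γ : Fin 4 → k := ![γ₀ 0, γ₀ 1, γ₁ 0, γ₁ 1] with hγdef
  set c : Fin 4 → Ad k := ![c₀ 0, c₀ 1, c₁ 0, c₁ 1] with hcdef
  have hγN : TorusData.IsNormOne D.d γ := by
    refine ⟨?_, ?_⟩
    · simpa [qnorm, γ, hDd] using hγ₀
    · simpa [qnorm, γ, hDd] using hγ₁
  have hcN : TorusData.IsNormOne (algebraMap k (Ad k) D.d) c := by
    refine ⟨?_, ?_⟩
    · simpa [qnorm, c, hDd] using hc₀N
    · simpa [qnorm, c, hDd] using hc₁N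
  have hρeq : ρ = TorusData.pmul (algebraMap k (Ad k) D.d) (fun i => algebraMap k (Ad k) (γ i)) c := by
    funext i
    fin_cases i
    · have := congrFun h₀ 0
      simp [qmul, qrat] at this
      simpa [TorusData.pmul, γ, c, hDd] using this
    · have := congrFun h₀ 1
      simp [qmul, qrat] at this
      simpa [TorusData.pmul, γ, c, hDd] using this
    · have := congrFun h₁ 0
      simp [qmul, qrat] at this
      simpa [TorusData.pmul, γ, c, hDd] using this
    · have := congrFun h₁ 1
      simp [qmul, qrat] at this
      simpa [TorusData.pmul, γ, c, hDd] using this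
  have hcK : (⟨c, hcN⟩ : N) ∈ (Subtype.val : N → (Fin 4 → Ad k)) ⁻¹' K :=
    ⟨(c₀, c₁), ⟨hc₀C, hc₁C⟩, rfl⟩
  refine ⟨⟨⟨torusElt D hDB hDOm (fun i => algebraMap k (Ad k) (γ i)) (isNormOne_map (algebraMap k (Ad k)) hγN),
    torusElt_mem D hDB hDOm hDP hP _ _⟩, ?_⟩, Φ ⟨c, hcN⟩, ⟨⟨c, hcN⟩, hcK, rfl⟩, ?_⟩
  · rw [rationalOf, Subgroup.mem_subgroupOf]
    exact torusElt_mem_rationalPoints D hDB hDOm γ hγN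
  · apply Subtype.ext
    rw [Subgroup.coe_mul, hx]
    show torusElt D hDB hDOm ρ hρ =
      torusElt D hDB hDOm (fun i => algebraMap k (Ad k) (γ i)) (isNormOne_map (algebraMap k (Ad k)) hγN) * torusElt D hDB hDOm c hcN
    rw [← torusElt_mul]
    congr 1

end Assembly

section Instances

/-- **R-c′ on an anisotropic genuine plane**: `torusT W = torusT(k) · C` with `C` compact. -/
theorem cocompact_rationalOf_torusT_of_anisotropic (hg : IsGenuineRow W) (hA : IsAnisotropic W) :
    ∃ C : Set (torusT W), IsCompact C ∧ ∀ x : torusT W, ∃ γ : rationalOf W (torusT W), ∃ c ∈ C,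
      x = (γ : torusT W) * c :=
  cocompact_rationalOf_commutant_pair_of_anisotropic hg hA (projPair_P W hg)

/-- **R-c″ on an anisotropic genuine plane**: `torusT' W = torusT'(k) · C` with `C` compact. -/
theorem cocompact_rationalOf_torusT'_of_anisotropic (hg : IsGenuineRow W) (hA : IsAnisotropic W) :
    ∃ C : Set (torusT' W), IsCompact C ∧ ∀ x : torusT' W, ∃ γ : rationalOf W (torusT' W), ∃ c ∈ C,
      x = (γ : torusT' W) * c :=
  cocompact_rationalOf_commutant_pair_of_anisotropic hg hA (projPair_Q W hg)

/-- typer-2's named form: `T` is cocompact modulo its rational points (anisotropic genuine plane). -/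
theorem isCocompactRational_torusT_of_anisotropic (hg : IsGenuineRow W) (hA : IsAnisotropic W) :
    IsCocompactRational W (torusT W) :=
  cocompact_rationalOf_torusT_of_anisotropic W hg hA

/-- typer-2's named form: `T′` is cocompact modulo its rational points (anisotropic genuine plane). -/
theorem isCocompactRational_torusT'_of_anisotropic (hg : IsGenuineRow W) (hA : IsAnisotropic W) :
    IsCocompactRational W (torusT' W) :=
  cocompact_rationalOf_torusT'_of_anisotropic W hg hA

/-- **`[T] = T(k)\T(𝔸_k)` is compact on an anisotropic genuine plane**: a relatively compact fundamental domain for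
every Haar measure (p5-g0's reduction `torus_quotient_compact_of_cocompact`). -/
theorem torus_quotient_compact_of_genuine_aniso (hg : IsGenuineRow W) (hA : IsAnisotropic W)
    [MeasurableSpace (GA W)] [BorelSpace (GA W)] (μT : Measure (torusT W)) [μT.IsHaarMeasure] :
    ∃ D : Set (torusT W), IsFundamentalDomain (rationalOf W (torusT W)) D μT ∧ IsCompact (closure D) :=
  torus_quotient_compact_of_cocompact W μT (cocompact_rationalOf_torusT_of_anisotropic W hg hA)

/-- **`[T′] = T′(k)\T′(𝔸_k)` is compact on an anisotropic genuine plane.** -/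
theorem torus'_quotient_compact_of_genuine_aniso (hg : IsGenuineRow W) (hA : IsAnisotropic W)
    [MeasurableSpace (GA W)] [BorelSpace (GA W)] (μT' : Measure (torusT' W)) [μT'.IsHaarMeasure] :
    ∃ D : Set (torusT' W), IsFundamentalDomain (rationalOf W (torusT' W)) D μT' ∧ IsCompact (closure D) :=
  torus'_quotient_compact_of_cocompact W μT' (cocompact_rationalOf_torusT'_of_anisotropic W hg hA)

/-- **THE RTF TORUS DATA FROM THE CHARACTERS ALONE, on an ANISOTROPIC genuine plane** (the wall's `R`, `_hR`,
`compT`, `compT'`): typer-2's `exists_rtfData_isHaar_closure` with its two cocompactness hypotheses discharged by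
`isCocompactRational_torusT_of_anisotropic` / `…torusT'…`.  For characters `χ`, `χ′` of the adelic tori —
multiplicative, trivial on the rational points, matching on the centre (the five character fields of `RTFData`) —
an `RTFData W` with THOSE characters exists whose torus measures are Haar and whose fundamental domains are
measurable and relatively compact. -/
theorem exists_rtfData_isHaar_closure_of_anisotropic [MeasurableSpace (torusT W)] [BorelSpace (torusT W)]
    [MeasurableSpace (torusT' W)] [BorelSpace (torusT' W)]
    (hg : IsGenuineRow W) (hA : IsAnisotropic W)
    (chi : torusT W → ℂ) (chi' : torusT' W → ℂ)
    (chi_mul : ∀ s t : torusT W, chi (s * t) = chi s * chi t)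
    (chi'_mul : ∀ s t : torusT' W, chi' (s * t) = chi' s * chi' t)
    (chi_rational : ∀ t : torusT W, (t : GA W) ∈ rationalPoints W → chi t = 1)
    (chi'_rational : ∀ t : torusT' W, (t : GA W) ∈ rationalPoints W → chi' t = 1)
    (chi_centre : ∀ (z : GA W) (hz : z ∈ centre W),
      chi ⟨z, centre_le_torusT W hz⟩ = chi' ⟨z, centre_le_torusT' W hz⟩) :
    ∃ R : RTFData W, R.chi = chi ∧ R.chi' = chi' ∧ R.IsHaar ∧ MeasurableSet R.DT ∧ MeasurableSet R.DT' ∧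
      IsCompact (closure R.DT) ∧ IsCompact (closure R.DT') :=
  exists_rtfData_isHaar_closure W chi chi' chi_mul chi'_mul chi_rational chi'_rational chi_centre
    (isCocompactRational_torusT_of_anisotropic W hg hA) (isCocompactRational_torusT'_of_anisotropic W hg hA)

end Instances

end Summit.Ventures.HodgeRepro.Tier4.Line4

end
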